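import Literature.Computability.MetaComplexity.EFSemModular
import HarnessLib

/-!
# Modular reduction `y mod n` as a netlist of modular adders, and its semantics

The template `ModRed.redT m L` reduces an `m`-bit number `y` modulo an `L`-bit modulus `n` by
the schoolbook shift-and-subtract recursion, most significant bit first, built entirely from
the uniform modular adder `ModAddU.modAddT L` (`EFModAddU.lean`): `r₀ = 0` and, for `t < m`,
`r_{t+1} = (2 r_t + y_{m-1-t}) mod n` computed as `A_t = D_t ⊕ₙ B_t` with `D_t = r_t ⊕ₙ r_t` and
`B_t` the one-bit word `(y_{m-1-t}, 0, …, 0)`; the zero bits are a kit input `zz` (as in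
`ModExpU.expT`). Inputs: `y` (`0 … L-1`, only the low `m` bits are read), `n` (`L … 2L-1`),
`zz` (`2L`).

* `ModRed.redT`, `ModRed.wf_redT` — the layout of the `2m` pieces and its well-formedness;
* `ModRed.wval_redT` — **the output word `r_m` carries `y mod n`** for `1 ≤ n`, `2n ≤ 2^L`,
  `zz = 0` (`ModRed.valR_eq`: `r_t = ⌊y / 2^{m-t}⌋ mod n`).

In the interpolation statements for the RSA pair (`Literature.Barriers.PneNP.RSAPairDisjointnessEFProofs`)
both certificates reduce the common input `y` by this same deterministic template, so that
inside extended Frege the two reduced words are identified by the generic congruence block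
(`Netlist.isBlock_leibLines`) — no law of division is needed on the proof side.

## Sources

* H. Vollmer, *Introduction to Circuit Complexity* (Springer 1999), §1.1–1.3 (subtraction by
  comparison, iterated straight-line arithmetic), Def. 1.6–1.7 (composition and semantics of
  circuits).
-/

namespace Literature.Computability.MetaComplexity

open _root_.Computability Complexity Complexity.PropForm Netlist

namespace ModRed

variable (m L : ℕ)

/-! ### The template -/

/-- Length of one piece (a modular adder). [folklore] -/
def PL (L : ℕ) : ℕ := 6 * L + 2

/-- Reference to bit `i` of the remainder `r_t`: the zero input for `t = 0`, the output of
`A_{t-1}` (piece `2t - 1`) otherwise. [folklore] -/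
def rRef (t i : ℕ) : ℕ ⊕ ℕ := if t = 0 then Sum.inl (2 * L) else Sum.inr ((2 * t - 1) * PL L + (5 * L + 2) + i)

/-- Wiring of the doubling `D_t = r_t ⊕ₙ r_t` (inputs of `modAddT`: `a, b, n`). [folklore] -/
def wD (t : ℕ) (i : ℕ) : ℕ ⊕ ℕ :=
  if i < L then rRef L t i else if i < 2 * L then rRef L t (i - L) else Sum.inl (L + (i - 2 * L))

/-- Reference to bit `j` of the one-bit word `B_t = (y_{m-1-t}, 0, …, 0)`. [folklore] -/
def bRef (t j : ℕ) : ℕ ⊕ ℕ := if j = 0 then Sum.inl (m - 1 - t) else Sum.inl (2 * L)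

/-- Wiring of the accumulation `A_t = R(D_t) ⊕ₙ B_t`. [folklore] -/
def wA (t : ℕ) (i : ℕ) : ℕ ⊕ ℕ :=
  if i < L then Sum.inr (2 * t * PL L + (5 * L + 2) + i) else if i < 2 * L then bRef m L t (i - L)
  else Sum.inl (L + (i - 2 * L))

/-- The pieces: `D_t` at `2t`, `A_t` at `2t + 1`. [cite: Vollmer1999, §1.2] -/
def pieces (k : ℕ) : Piece :=
  if k % 2 = 0 then ⟨ModAddU.modAddT L, 3 * L, wD L (k / 2)⟩ else ⟨ModAddU.modAddT L, 3 * L, wA m L (k / 2)⟩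

/-- **The reduction template** `y mod n`: the layout of the `2m` pieces. [cite: Vollmer1999, §1.2–1.3] -/
def redT (m L : ℕ) : Template := layout (pieces m L) (2 * m)

/-- Every piece is a modular adder. [folklore] -/
theorem pieces_T (k : ℕ) : (pieces m L k).T = ModAddU.modAddT L ∧ (pieces m L k).nIn = 3 * L := by
  unfold pieces; split_ifs <;> exact ⟨rfl, rfl⟩

/-- **The offsets are uniform**: piece `k` sits at `k · (6L + 2)`. [folklore] -/
theorem offset_pieces : ∀ k, offset (pieces m L) k = k * PL L
  | 0 => by simp
  | k + 1 => by rw [offset_succ, offset_pieces k, (pieces_T m L k).1, ModAddU.length_modAddT, PL]; ring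

/-- Length of the reduction template. [folklore] -/
@[simp] theorem length_redT : (redT m L).length = 2 * m * (6 * L + 2) := by
  rw [redT, length_layout, offset_pieces]; rfl

/-- The doubling pieces. [folklore] -/
theorem pieces_D (t : ℕ) : pieces m L (2 * t) = ⟨ModAddU.modAddT L, 3 * L, wD L t⟩ := by
  unfold pieces; rw [if_pos (by omega), show 2 * t / 2 = t by omega]

/-- The accumulation pieces. [folklore] -/
theorem pieces_A (t : ℕ) : pieces m L (2 * t + 1) = ⟨ModAddU.modAddT L, 3 * L, wA m L t⟩ := by
  unfold pieces; rw [if_neg (by omega), show (2 * t + 1) / 2 = t by omega]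

/-- References to `r_t` are in range before piece `2t`. [folklore] -/
theorem rRef_ok {t i : ℕ} (hi : i < L) :
    (∀ a, rRef L t i = Sum.inl a → a < 2 * L + 1) ∧ (∀ g, rRef L t i = Sum.inr g → g < 2 * t * PL L) := by
  unfold rRef; split_ifs with h
  · exact ⟨fun a ha => (by cases ha; omega), fun g hg => by cases hg⟩
  · refine ⟨fun a ha => (by cases ha), fun g hg => ?_⟩
    cases hg
    have e : 2 * t * PL L = (2 * t - 1) * PL L + PL L := by
      rw [← Nat.succ_mul]; congr 1; omega
    rw [e, PL]; omega

/-- Every piece is well formed and well wired (`2L + 1` inputs), provided `m ≤ L`.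
[cite: Vollmer1999, Def. 1.6] -/
theorem piece_ok (hm : m ≤ L) : ∀ k < 2 * m, Piece.OK (pieces m L) (2 * L + 1) k := by
  intro k hk
  unfold Piece.OK
  rw [offset_pieces]
  obtain ⟨t, rfl | rfl⟩ : ∃ t, k = 2 * t ∨ k = 2 * t + 1 := ⟨k / 2, by omega⟩
  · rw [pieces_D]
    refine ⟨ModAddU.wf_modAddT L, fun i hi => ?_⟩
    dsimp only at hi ⊢; unfold wD
    split_ifs with h1 h2
    · exact rRef_ok L h1
    · exact rRef_ok L (by omega)
    · exact ⟨fun a ha => (by cases ha; omega), fun g hg => by cases hg⟩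
  · rw [pieces_A]
    refine ⟨ModAddU.wf_modAddT L, fun i hi => ?_⟩
    dsimp only at hi ⊢; unfold wA
    split_ifs with h1 h2
    · refine ⟨fun a ha => (by cases ha), fun g hg => ?_⟩
      cases hg
      have e : (2 * t + 1) * PL L = 2 * t * PL L + PL L := by ring
      have hP : 5 * L + 2 + i < PL L := by unfold PL; omega
      rw [e]; omega
    · unfold bRef; split_ifs
      · exact ⟨fun a ha => (by cases ha; omega), fun g hg => by cases hg⟩
      · exact ⟨fun a ha => (by cases ha; omega), fun g hg => by cases hg⟩
    · exact ⟨fun a ha => (by cases ha; omega), fun g hg => by cases hg⟩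

/-- **The reduction template is well formed** (`2L + 1` inputs, `m ≤ L`). [cite: Vollmer1999, Def. 1.6] -/
theorem wf_redT (hm : m ≤ L) : (redT m L).WF (2 * L + 1) := wf_layout (pieces m L) (piece_ok m L hm)

/-! ### Semantics -/

variable (inp : ℕ → Bool)

/-- The low `m` bits of `y` (inputs `0 … m-1`). [folklore] -/
def valY : ℕ := wval (fun i => inp i) m
/-- The modulus `n` (inputs `L … 2L-1`). [folklore] -/
def valN : ℕ := wval (fun i => inp (L + i)) L
/-- The value read through a reference. [folklore] -/
def rv (r : ℕ ⊕ ℕ) : Bool := refVal inp (wireVal (redT m L) inp) r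
/-- The number carried by the remainder `r_t`. [folklore] -/
def valR (t : ℕ) : ℕ := wval (fun i => rv m L inp (rRef L t i)) L

/-- The wires of piece `k < 2m`. [cite: Vollmer1999, Def. 1.7] -/
theorem wireVal_piece (hm : m ≤ L) {k : ℕ} (hk : k < 2 * m) {j : ℕ} (hj : j < (pieces m L k).T.length) :
    wireVal (redT m L) inp (k * PL L + j) = wireVal (pieces m L k).T (fun i => rv m L inp ((pieces m L k).wire i)) j := by
  have h := wireVal_layout (pieces m L) (N := 2 * m) (piece_ok m L hm) inp hk hj
  rw [offset_pieces] at h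
  exact h

/-- `r_0` is the zero word (`zz = 0`). [folklore] -/
theorem valR_zero (hzz : inp (2 * L) = false) : valR m L inp 0 = 0 :=
  wval_eq_zero fun i _ => by simp [rv, rRef, refVal, hzz]

/-- The inputs read by `D_t`: `(r_t, r_t, n)`. [folklore] -/
def inpD (t : ℕ) (i : ℕ) : Bool :=
  if i < L then rv m L inp (rRef L t i) else if i < 2 * L then rv m L inp (rRef L t (i - L)) else inp (L + (i - 2 * L))

/-- **The doubling `D_t`** carries the wires of `modAddT L` on `(r_t, r_t, n)`. [cite: Vollmer1999, Def. 1.7] -/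
theorem wireVal_D (hm : m ≤ L) {t : ℕ} (ht : t < m) {j : ℕ} (hj : j < (ModAddU.modAddT L).length) :
    wireVal (redT m L) inp (2 * t * PL L + j) = wireVal (ModAddU.modAddT L) (inpD m L inp t) j := by
  have h := wireVal_piece m L inp hm (k := 2 * t) (by omega) (j := j) (by rw [pieces_D]; exact hj)
  rw [pieces_D] at h
  refine h.trans (wireVal_congr (ModAddU.wf_modAddT L) (fun i hi => ?_) hj)
  show rv m L inp (wD L t i) = inpD m L inp t i
  unfold wD inpD; split_ifs <;> rfl

/-- The inputs read by `A_t`: `(R(D_t), B_t, n)`. [folklore] -/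
def inpA (t : ℕ) (i : ℕ) : Bool :=
  if i < L then wireVal (redT m L) inp (2 * t * PL L + (5 * L + 2) + i) else if i < 2 * L then rv m L inp (bRef m L t (i - L))
  else inp (L + (i - 2 * L))

/-- **The accumulation `A_t`** carries the wires of `modAddT L` on `(R(D_t), B_t, n)`.
[cite: Vollmer1999, Def. 1.7] -/
theorem wireVal_A (hm : m ≤ L) {t : ℕ} (ht : t < m) {j : ℕ} (hj : j < (ModAddU.modAddT L).length) :
    wireVal (redT m L) inp ((2 * t + 1) * PL L + j) = wireVal (ModAddU.modAddT L) (inpA m L inp t) j := by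
  have h := wireVal_piece m L inp hm (k := 2 * t + 1) (by omega) (j := j) (by rw [pieces_A]; exact hj)
  rw [pieces_A] at h
  refine h.trans (wireVal_congr (ModAddU.wf_modAddT L) (fun i hi => ?_) hj)
  show rv m L inp (wA m L t i) = inpA m L inp t i
  unfold wA inpA; split_ifs <;> rfl

/-- The operands of `D_t` carry `r_t`, `r_t`, `n`. [folklore] -/
theorem val_inpD (t : ℕ) :
    ModAddU.valA L (inpD m L inp t) = valR m L inp t ∧ ModAddU.valB L (inpD m L inp t) = valR m L inp t ∧
      ModAddU.valN L (inpD m L inp t) = valN L inp := by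
  refine ⟨wval_congr fun i hi => ?_, wval_congr fun i hi => ?_, wval_congr fun i hi => ?_⟩ <;> unfold inpD
  · rw [if_pos hi]
  · rw [if_neg (by omega), if_pos (by omega), Nat.add_sub_cancel_left]
  · rw [if_neg (by omega), if_neg (by omega), Nat.add_sub_cancel_left]

/-- The operands of `A_t` carry `R(D_t)`, `B_t = y_{m-1-t}`, `n` (`zz = 0`, `0 < L`). [folklore] -/
theorem val_inpA (hL : 0 < L) (hzz : inp (2 * L) = false) {t : ℕ} (ht : t < m) :
    ModAddU.valA L (inpA m L inp t) = wval (fun i => wireVal (redT m L) inp (2 * t * PL L + (5 * L + 2) + i)) L ∧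
      ModAddU.valB L (inpA m L inp t) = ((valY m inp).testBit (m - 1 - t)).toNat ∧
      ModAddU.valN L (inpA m L inp t) = valN L inp := by
  refine ⟨wval_congr fun i hi => ?_, ?_, wval_congr fun i hi => ?_⟩
  · unfold inpA; rw [if_pos hi]
  · unfold valY
    rw [testBit_wval _ (by omega)]
    have h : wval (fun i => inpA m L inp t (L + i)) L = wval (fun i => decide (i = 0) && inp (m - 1 - t)) L :=
      wval_congr fun i hi => by
        unfold inpA; rw [if_neg (by omega), if_pos (by omega), Nat.add_sub_cancel_left]
        unfold rv bRef; split_ifs with h0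
        · subst h0; simp [refVal]
        · simp [refVal, hzz, h0]
    unfold ModAddU.valB
    rw [h]
    cases hb : inp (m - 1 - t)
    · simp only [Bool.and_false, Bool.toNat_false]; exact wval_eq_zero fun i _ => rfl
    · simp only [Bool.and_true, Bool.toNat_true]; exact wval_onehot hL fun i _ => rfl
  · unfold inpA; rw [if_neg (by omega), if_neg (by omega), Nat.add_sub_cancel_left]

/-- **One stage**: `r_{t+1} = (2 r_t + y_{m-1-t}) mod n`, for `r_t < n`, `1 ≤ n`, `2n ≤ 2^L`, `zz = 0`.
[cite: Vollmer1999, §1.1–1.3] -/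
theorem valR_succ (hm : m ≤ L) (hzz : inp (2 * L) = false) {t : ℕ} (ht : t < m) (hR : valR m L inp t < valN L inp)
    (hn1 : 1 ≤ valN L inp) (hn : 2 * valN L inp ≤ 2 ^ L) :
    valR m L inp (t + 1) = (2 * valR m L inp t + ((valY m inp).testBit (m - 1 - t)).toNat) % valN L inp := by
  have hL : 0 < L := by omega
  obtain ⟨hDA, hDB, hDN⟩ := val_inpD m L inp t
  obtain ⟨hAA, hAB, hAN⟩ := val_inpA m L inp hL hzz ht
  -- the doubled word
  have hD : wval (fun i => wireVal (redT m L) inp (2 * t * PL L + (5 * L + 2) + i)) L = (2 * valR m L inp t) % valN L inp := by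
    have h := ModAddU.wval_R_modAddT_mod L (inpD m L inp t) (by rw [hDA, hDN]; exact hR) (by rw [hDB, hDN]; exact hR)
      (by rw [hDN]; exact hn)
    rw [hDA, hDB, hDN, ← two_mul] at h
    rw [← h]
    exact wval_congr fun i hi => by rw [Nat.add_assoc]; exact wireVal_D m L inp hm ht (j := 5 * L + 2 + i) (by simp; omega)
  -- the accumulated word
  have hbit : ((valY m inp).testBit (m - 1 - t)).toNat ≤ 1 := toNat_le_one _
  have hDlt : (2 * valR m L inp t) % valN L inp < valN L inp := Nat.mod_lt _ (by omega)
  have h := ModAddU.wval_R_modAddT L (inpA m L inp t) (by rw [hAA, hAB, hD]; omega)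
  rw [hAA, hAB, hAN, hD] at h
  have e : valR m L inp (t + 1) = wval (fun i => wireVal (ModAddU.modAddT L) (inpA m L inp t) (5 * L + 2 + i)) L := by
    refine wval_congr fun i hi => ?_
    simp only [rv, rRef, Nat.add_eq_zero_iff, one_ne_zero, and_false, if_false, refVal, show 2 * (t + 1) - 1 = 2 * t + 1 by omega]
    rw [Nat.add_assoc]
    exact wireVal_A m L inp hm ht (j := 5 * L + 2 + i) (by simp; omega)
  have key : ∀ A : ℕ, A < 2 * valN L inp → (if valN L inp ≤ A then A - valN L inp else A) = A % valN L inp := by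
    intro A hA; split_ifs with hc
    · rw [Nat.mod_eq_sub_mod hc, Nat.mod_eq_of_lt]; omega
    · rw [Nat.mod_eq_of_lt]; omega
  rw [e, h, key _ (by omega), Nat.mod_add_mod]

/-- **The invariant of the reduction**: `r_t = ⌊y / 2^{m-t}⌋ mod n` for `t ≤ m` (`1 ≤ n`, `2n ≤ 2^L`,
`zz = 0`). [cite: Vollmer1999, §1.1–1.3] -/
theorem valR_eq (hm : m ≤ L) (hzz : inp (2 * L) = false) (hn1 : 1 ≤ valN L inp) (hn : 2 * valN L inp ≤ 2 ^ L) :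
    ∀ {t : ℕ}, t ≤ m → valR m L inp t = (valY m inp / 2 ^ (m - t)) % valN L inp
  | 0, _ => by
    rw [valR_zero m L inp hzz, Nat.sub_zero, Nat.div_eq_of_lt (show valY m inp < 2 ^ m from wval_lt _ m), Nat.zero_mod]
  | t + 1, ht => by
    have ih := valR_eq hm hzz hn1 hn (t := t) (by omega)
    have hq : valY m inp / 2 ^ (m - (t + 1)) = 2 * (valY m inp / 2 ^ (m - t)) + ((valY m inp).testBit (m - (t + 1))).toNat := by
      rw [show m - t = m - (t + 1) + 1 by omega]; exact div_pow_eq_bit _ _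
    rw [valR_succ m L inp hm hzz (by omega) (by rw [ih]; exact Nat.mod_lt _ (by omega)) hn1 hn, ih, hq,
      show m - 1 - t = m - (t + 1) by omega]
    exact ((Nat.mod_modEq _ _).mul_left 2).add_right _

/-- **The reduction template reduces**: the output word `r_m` — the gates
`(2m - 1)(6L + 2) + (5L + 2) + i` for `0 < m` — carries `y mod n` (`y` the low `m` input bits), for
`m ≤ L`, `1 ≤ n`, `2n ≤ 2^L` and zero input `zz = 0`. [cite: Vollmer1999, §1.1–1.3] -/
theorem wval_redT (hm : m ≤ L) (hzz : inp (2 * L) = false) (hn1 : 1 ≤ valN L inp) (hn : 2 * valN L inp ≤ 2 ^ L) :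
    valR m L inp m = valY m inp % valN L inp := by
  rw [valR_eq m L inp hm hzz hn1 hn le_rfl, Nat.sub_self, Nat.pow_zero, Nat.div_one]

/-- The output word read as gates (`0 < m`). [folklore] -/
theorem valR_out (hm0 : 0 < m) :
    valR m L inp m = wval (fun i => wireVal (redT m L) inp ((2 * m - 1) * PL L + (5 * L + 2) + i)) L :=
  wval_congr fun i _ => by simp only [rv, rRef, Nat.pos_iff_ne_zero.1 hm0, if_false, refVal]

/-- The output word of the reduction is below `n`. [folklore] -/
theorem valR_lt (hm : m ≤ L) (hzz : inp (2 * L) = false) (hn1 : 1 ≤ valN L inp) (hn : 2 * valN L inp ≤ 2 ^ L) :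
    valR m L inp m < valN L inp := by
  rw [wval_redT m L inp hm hzz hn1 hn]; exact Nat.mod_lt _ (by omega)

end ModRed

end Literature.Computability.MetaComplexity
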